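import Summits.Ventures.PercRepro.BlockSum

/-!
# PercRepro — C-025 on `T_p(B ⊕ U_{m,m})` from the BASE-LAYER inequalities alone (p9, gen 14)

`proofs/P9-S4-LINELADDER-g13.md` §6, closed under the `q`-descent: for a finite set of orbit profiles with
`c ≤ k₁ X + k₂ X` for every profile (`c` = the first active offset: `m₀(p, q) = p + q − c`), the profile inequality
`Φ(p,q)·U ≤ Y` at EVERY `(p, q, m)` with `q + 2 ≤ p`, `m ≥ p + q − c` follows from the inequalities AT THE BASE LAYER
`m = p + q − c` alone, for every `(p, q)` (`profiles_ineq_of_baseLayer`: strong induction on `q` through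
`profiles_ineq_of_base`, whose hypothesis at the lower levels `(p − j, q − j)` on the layer `p + q − c` is the
induction hypothesis). The matroid form `rls_blockFree_of_baseLayer`: ONE two-parameter base-layer inequality per block
gives C-025 on `T_p(B ⊕ U_{m,m})` for every `(p, q)` and every `m ≥ p + q − c` — the `m`- and `q`-inductions of
`K4LadderArith` (`k4_rs`, the levels) are never repeated for the next block. Nothing here is about any window of S4.
-/

namespace PercRepro.LineLadder

open Set Finset

/-- **The generic step from the base layers alone**: if every profile has `c ≤ k₁ + k₂` and the profile inequality holds
at the base layer `m = p + q − c` for every `(p, q)` with `q + 2 ≤ p`, then it holds at every `(p, q, m)` with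
`q + 2 ≤ p` and `p + q − c ≤ m`. -/
theorem profiles_ineq_of_baseLayer {ι : Type*} (𝒳 : Finset ι) (k₁ k₂ : ι → ℕ) (c : ℕ)
    (hact : ∀ X ∈ 𝒳, c ≤ k₁ X + k₂ X)
    (hbase : ∀ p q : ℕ, q + 2 ≤ p →
      phiK p q * ((∑ X ∈ 𝒳, ∑ a ∈ range (p + q - c + 1),
          (if min p (k₁ X + a) = p ∧ min p (k₂ X + (p + q - c - a)) = q then (p + q - c).choose a else 0) : ℕ) : ℚ)
        ≤ ((∑ X ∈ 𝒳, ∑ a ∈ range (p + q - c + 1),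
          (if q < min p (k₁ X + a) ∧ min p (k₁ X + a) < p then (p + q - c).choose a else 0) : ℕ) : ℚ)) :
    ∀ q p m : ℕ, q + 2 ≤ p → p + q - c ≤ m →
      phiK p q * ((∑ X ∈ 𝒳, ∑ a ∈ range (m + 1),
          (if min p (k₁ X + a) = p ∧ min p (k₂ X + (m - a)) = q then m.choose a else 0) : ℕ) : ℚ)
        ≤ ((∑ X ∈ 𝒳, ∑ a ∈ range (m + 1),
          (if q < min p (k₁ X + a) ∧ min p (k₁ X + a) < p then m.choose a else 0) : ℕ) : ℚ) := by
  intro q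
  induction q using Nat.strong_induction_on with
  | _ q ih =>
    intro p m hpq hm
    refine profiles_ineq_of_base 𝒳 k₁ k₂ q p (p + q - c) hpq (fun X hX => by have := hact X hX; omega) ?_ m hm
    intro j hj
    rcases Nat.eq_zero_or_pos j with hj0 | hj0
    · subst hj0
      simpa using hbase p q hpq
    · exact ih (q - j) (by omega) (p - j) (p + q - c) (by omega) (by omega)

variable {α : Type}

/-- **C-025 ON `T_p(B ⊕ U_{m,m})` FROM THE BASE LAYERS ALONE** (the matroid form): for a finite block `B` with
`c ≤ ρ_B X + ρ_B(B.E ∖ X)` for every `X ⊆ B.E`, if the profile inequality holds at the base layer `m = p + q − c`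
for every `(p, q)` with `q + 2 ≤ p`, then `RLS` holds for `T_p(B ⊕ U_{m,m})` at every `(p, q)` with `q + 2 ≤ p` and
every `m ≥ p + q − c`. -/
theorem rls_blockFree_of_baseLayer (B : Matroid α) [B.Finite] {F : Set α} (hF : F.Finite)
    (hBF : Disjoint B.E (Matroid.freeOn F).E) (c : ℕ)
    (hact : ∀ X ⊆ B.E, c ≤ (B.eRk X).toNat + (B.eRk (B.E \ X)).toNat)
    (hbase : ∀ p q : ℕ, q + 2 ≤ p →
      phiK p q * ((∑ X ∈ B.ground_finite.finite_subsets.toFinset, ∑ a ∈ range (p + q - c + 1),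
          (if min p ((B.eRk X).toNat + a) = p ∧ min p ((B.eRk (B.E \ X)).toNat + (p + q - c - a)) = q
            then (p + q - c).choose a else 0) : ℕ) : ℚ)
        ≤ ((∑ X ∈ B.ground_finite.finite_subsets.toFinset, ∑ a ∈ range (p + q - c + 1),
          (if q < min p ((B.eRk X).toNat + a) ∧ min p ((B.eRk X).toNat + a) < p
            then (p + q - c).choose a else 0) : ℕ) : ℚ))
    (p q : ℕ) (hpq : q + 2 ≤ p) (hm : p + q - c ≤ F.ncard) :
    @ThmN.RLS α (@PercRepro.Matroid.truncate α (B.disjointSum (Matroid.freeOn F) hBF) (blockFree_finite B hF hBF) p)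
      (@PercRepro.Matroid.truncate_finite α _ (blockFree_finite B hF hBF) p) p q := by
  unfold ThmN.RLS
  rw [ncard_U_blockFree' B hF hBF p q, ncard_Y_blockFree' B hF hBF p q]
  exact profiles_ineq_of_baseLayer B.ground_finite.finite_subsets.toFinset (fun X => (B.eRk X).toNat)
    (fun X => (B.eRk (B.E \ X)).toNat) c
    (fun X hX => hact X (by rwa [Set.Finite.mem_toFinset, mem_setOf_eq] at hX)) hbase q p F.ncard hpq hm

end PercRepro.LineLadder
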